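import Mathlib

/-!
# LINE `valuative_door` (crux `WeakLifting`, stmt-ValiantsHypothesis-19561) — the ANTI-MONGE LEMMA and the GRAM IDENTITY behind the
# calibration `ValTwoFourCalibration` (v(2,4) = 8)

HONEST FRAMING.  Helper (cell `pub-symmetroid`, seat val-sym-lift-p1 g22, 2026-08-29; `--supports 19561 --as helper`).  Two elementary pieces of
crit-6 g4's anti-Monge argument for the skeleton's calibration target `ValTwoFourCalibration : ValRootLawAt 2 4 8` (VERDICT #54 (g)): (1) the
ANTI-MONGE LEMMA (`sum_perm_lt_sum_rev`): if a symmetric table `x p q` on letters with strictly increasing slopes `d` is STRICTLY CONCAVE along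
equal slope-sums («outer pair < inner pair»), then among all permutations `σ` the REVERSAL uniquely maximises `Σ_l x l (σ l)` (swap a
non-inversion; the measure `Σ l·σ(l)` drops); (2) the GRAM IDENTITY (`det_gram_polarDet_eq_zero`): for four `2 × 2` symmetric letters
`(a_l, b_l, c_l)` the `4 × 4` matrix of the polarised determinant `a_l c_{l'} + a_{l'} c_l − 2 b_l b_{l'}` is singular (four vectors in a
3-space).  Consumed by `…ValuativeDoorTwoFourCalibration`.  Pure algebra/combinatorics; closes nothing; no bearing on vW / vB, `TropicalB`,
`MatrixDescartes` (18050) or VP ≠ VNP.  [elementary; Monge arrays folklore]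
-/

set_option linter.dupNamespace false
set_option autoImplicit false

namespace Summit.ValiantsHypothesis.ValiantsHypothesis.Theorems.KPlusLogSqLaw.ValDoor

open Finset
open scoped BigOperators Classical

/-! ## §1 The reversal is the only strictly decreasing permutation -/

/-- a permutation of `Fin n` that reverses every comparison is the reversal. [bookkeeping: `StrictMono.range_inj`] -/
theorem eq_revPerm_of_forall_lt {n : ℕ} (σ : Equiv.Perm (Fin n)) (h : ∀ i j : Fin n, i < j → σ j < σ i) : σ = Fin.revPerm := by
  have hf : StrictMono fun l : Fin n => σ (Fin.rev l) := fun l l' hll' => h _ _ (Fin.rev_lt_rev.2 hll')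
  have hrange : Set.range (fun l : Fin n => σ (Fin.rev l)) = Set.range (id : Fin n → Fin n) := by
    rw [Set.range_id, Set.eq_univ_iff_forall]
    intro y
    exact ⟨Fin.rev (σ.symm y), by simp⟩
  have hid := (StrictMono.range_inj hf strictMono_id).1 hrange
  ext l
  have := congrFun hid (Fin.rev l)
  simp only [Fin.rev_rev, id] at this
  rw [Fin.revPerm_apply, this]

/-! ## §2 The anti-Monge lemma -/

/-- **one swap of a non-inversion raises the sum and lowers the measure `Σ l·σ(l)`.** [elementary] -/
theorem exists_swap_improve {n : ℕ} (x : Fin n → Fin n → ℝ) (d : Fin n → ℕ) (hd : StrictMono d)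
    (hconc : ∀ p₁ q₁ p₂ q₂ p₃ q₃ p₄ q₄ : Fin n,
      d p₁ + d q₁ + (d p₄ + d q₄) = d p₂ + d q₂ + (d p₃ + d q₃) →
      d p₁ + d q₁ < d p₂ + d q₂ → d p₁ + d q₁ < d p₃ + d q₃ → x p₁ q₁ + x p₄ q₄ < x p₂ q₂ + x p₃ q₃)
    (σ : Equiv.Perm (Fin n)) (hσ : σ ≠ Fin.revPerm) :
    ∃ σ' : Equiv.Perm (Fin n), ∑ l : Fin n, l.val * (σ' l).val < ∑ l : Fin n, l.val * (σ l).val ∧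
      ∑ l, x l (σ l) < ∑ l, x l (σ' l) := by
  -- a non-inversion i < j, σ i < σ j
  have hex : ∃ i j : Fin n, i < j ∧ σ i < σ j := by
    by_contra hno
    push Not at hno
    exact hσ (eq_revPerm_of_forall_lt σ fun i j hij => lt_of_le_of_ne (hno i j hij) fun heq => (ne_of_lt hij) (σ.injective heq.symm))
  obtain ⟨i, j, hij, hσij⟩ := hex
  have hne : i ≠ j := ne_of_lt hij
  refine ⟨(Equiv.swap i j).trans σ, ?_, ?_⟩
  · -- the measure drops: i σ(j) + j σ(i) < i σ(i) + j σ(j)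
    have hsplit : ∀ g : Fin n → ℕ, ∑ l : Fin n, g l = g i + (g j + ∑ l ∈ (univ.erase i).erase j, g l) := by
      intro g
      rw [← Finset.add_sum_erase _ g (Finset.mem_univ i), ← Finset.add_sum_erase _ g (Finset.mem_erase.2 ⟨hne.symm, Finset.mem_univ j⟩)]
    rw [hsplit (fun l : Fin n => l.val * (((Equiv.swap i j).trans σ) l).val), hsplit (fun l : Fin n => l.val * (σ l).val)]
    have hrest : ∑ l ∈ (univ.erase i).erase j, l.val * (((Equiv.swap i j).trans σ) l).val
        = ∑ l ∈ (univ.erase i).erase j, l.val * (σ l).val := by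
      refine Finset.sum_congr rfl fun l hl => ?_
      have hlj : l ≠ j := (Finset.mem_erase.1 hl).1
      have hli : l ≠ i := (Finset.mem_erase.1 (Finset.mem_erase.1 hl).2).1
      simp only [Equiv.trans_apply, Equiv.swap_apply_of_ne_of_ne hli hlj]
    rw [hrest]
    simp only [Equiv.trans_apply, Equiv.swap_apply_left, Equiv.swap_apply_right]
    have h1 : (i : ℕ) < j := Fin.lt_def.1 hij
    have h2 : (σ i : ℕ) < σ j := Fin.lt_def.1 hσij
    nlinarith
  · -- the sum rises: outer pair < inner pair
    have hsplit : ∀ g : Fin n → ℝ, ∑ l : Fin n, g l = g i + (g j + ∑ l ∈ (univ.erase i).erase j, g l) := by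
      intro g
      rw [← Finset.add_sum_erase _ g (Finset.mem_univ i), ← Finset.add_sum_erase _ g (Finset.mem_erase.2 ⟨hne.symm, Finset.mem_univ j⟩)]
    rw [hsplit (fun l => x l (((Equiv.swap i j).trans σ) l)), hsplit (fun l => x l (σ l))]
    have hrest : ∑ l ∈ (univ.erase i).erase j, x l (((Equiv.swap i j).trans σ) l) = ∑ l ∈ (univ.erase i).erase j, x l (σ l) := by
      refine Finset.sum_congr rfl fun l hl => ?_
      have hlj : l ≠ j := (Finset.mem_erase.1 hl).1
      have hli : l ≠ i := (Finset.mem_erase.1 (Finset.mem_erase.1 hl).2).1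
      simp only [Equiv.trans_apply, Equiv.swap_apply_of_ne_of_ne hli hlj]
    rw [hrest]
    simp only [Equiv.trans_apply, Equiv.swap_apply_left, Equiv.swap_apply_right]
    have key := hconc i (σ i) i (σ j) j (σ i) j (σ j) (by ring) (Nat.add_lt_add_left (hd hσij) _)
      (Nat.add_lt_add_right (hd hij) _)
    linarith

/-- **THE ANTI-MONGE LEMMA:** under strict concavity along equal slope-sums, the reversal is the unique maximiser of `σ ↦ Σ_l x l (σ l)`.
[elementary; induction on the measure `Σ l·σ(l)`] -/
theorem sum_perm_lt_sum_rev {n : ℕ} (x : Fin n → Fin n → ℝ) (d : Fin n → ℕ) (hd : StrictMono d)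
    (hconc : ∀ p₁ q₁ p₂ q₂ p₃ q₃ p₄ q₄ : Fin n,
      d p₁ + d q₁ + (d p₄ + d q₄) = d p₂ + d q₂ + (d p₃ + d q₃) →
      d p₁ + d q₁ < d p₂ + d q₂ → d p₁ + d q₁ < d p₃ + d q₃ → x p₁ q₁ + x p₄ q₄ < x p₂ q₂ + x p₃ q₃) :
    ∀ (N : ℕ) (σ : Equiv.Perm (Fin n)), ∑ l : Fin n, l.val * (σ l).val ≤ N → σ ≠ Fin.revPerm →
      ∑ l, x l (σ l) < ∑ l, x l (Fin.revPerm l) := by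
  intro N
  induction N with
  | zero =>
    intro σ hN hσ
    obtain ⟨σ', hμ, -⟩ := exists_swap_improve x d hd hconc σ hσ
    omega
  | succ N ih =>
    intro σ hN hσ
    obtain ⟨σ', hμ, hsum⟩ := exists_swap_improve x d hd hconc σ hσ
    by_cases hσ' : σ' = Fin.revPerm
    · rw [hσ'] at hsum; exact hsum
    · exact hsum.trans (ih σ' (by omega) hσ')

/-! ## §3 The Gram identity for four `2 × 2` symmetric letters -/

/-- **four vectors in a 3-space have a singular Gram matrix** for the polarised determinant form
`β((a,b,c),(a',b',c')) = a c' + a' c − 2 b b'`: `det (β(S_l, S_{l'}))_{l,l' < 4} = 0`. [elementary: the `4 × 4` Gram matrix factors through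
a `4 × 4` matrix with a zero column] -/
theorem det_gram_polarDet_eq_zero {F : Type*} [Field F] (a b c : Fin 4 → F) :
    (Matrix.of fun l l' : Fin 4 => a l * c l' + a l' * c l - 2 * b l * b l').det = 0 := by
  set A : Matrix (Fin 4) (Fin 4) F := Matrix.of fun l t => ![a l, b l, c l, 0] t with hA
  set B : Matrix (Fin 4) (Fin 4) F := Matrix.of fun t l' => ![c l', -2 * b l', a l', 0] t with hB
  have hAB : (Matrix.of fun l l' : Fin 4 => a l * c l' + a l' * c l - 2 * b l * b l') = A * B := by
    ext l l'
    rw [Matrix.mul_apply, Fin.sum_univ_four]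
    simp [hA, hB]
    ring
  have hdetA : A.det = 0 := Matrix.det_eq_zero_of_column_eq_zero 3 fun l => by simp [hA]
  rw [hAB, Matrix.det_mul, hdetA, zero_mul]

end Summit.ValiantsHypothesis.ValiantsHypothesis.Theorems.KPlusLogSqLaw.ValDoor
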